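import Literature.IUT.HodgeArakelov.MonoThetaProjectiveThetaEnv
import Literature.IUT.HodgeTheaters.DiscreteProfiniteCompletionsProofs

/-!
# The limit cyclotomic rigidity `(l·Δ_Θ)(𝕄_*) ⥲ Π_μ(𝕄_*)` of [IUTchII] Prop. 1.5 (iii) IS an isomorphism
# (proof-only companion of bridge B8 part 5d): `hlim` discharged from `(l·Δ_Θ)/thetaKer ≅ Ẑ`

Proof-only companion (abc-iut cell, D-0067 wave 4, seat abc-iut-w4-d030; DAG node **IUTchII:Prop1.5(iii)**,
GAP-LEDGER G-w4d030-2) of `MonoThetaProjectiveThetaEnv.lean` (`EtaleLevels.rigidLimHom`, `EtaleLevels.thetaEnvData`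
modulo `hlim : Function.Bijective rigidLimHom`). NO definition, NO new named fact.

S. Mochizuki, *Inter-universal Teichmüller theory II*, kurims manuscript (Dec. 2020), Prop. 1.5 (iii) p. 29: "a
projective limit exterior cyclotome `Π_μ(M^Θ_*)` which is equipped with a uniquely determined cyclotomic rigidity
isomorphism `(l·Δ_Θ)(M^Θ_*) ⥲ Π_μ(M^Θ_*)`" [claim: Mochizuki2012, status: disputed] (IUTchII §1 Prop 1.5 (iii), kurims
p.29); S. Mochizuki, *The étale theta function …*, Publ. RIMS **45** (2009), §1 p. 238 (PRIMS PDF p. 12), `Δ_Θ ≅ Ẑ(1)`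
[cite: MochizukiEtTh2009, Cor 2.19(i) p.64].

What is PROVED here:
* two folklore facts about `Ẑ` (the tree's `Literature.IUT.HodgeTheaters.ZHat` = Mathlib's profinite completion of
  `ℤ`): `zHat_eq_one_of_forall_exists_pow_eq` — an element which is an `M`-th power for every `M ≥ 1` is trivial
  (`⋂_M Ẑ^M = 1`: read in the finite quotient of index `M`); `zHat_exists_of_powCompatible` — every family
  `(a_M)_{M ≥ 1}` with `a_{M'} ∈ a_M Ẑ^M` for `M ∣ M'` is interpolated by one `z ∈ ⋂_M a_M Ẑ^M` (compactness of
  `Ẑ`: the cosets `a_M Ẑ^M` are a directed family of non-empty compact closed sets); both transported along any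
  abstract group isomorphism `B ≃* Ẑ` (`eq_one_of_forall_exists_pow_eq_of_mulEquiv_zHat`,
  `exists_of_powCompatible_of_mulEquiv_zHat`);
* `EtaleLevels.exists_pow_eq_of_intCompat_eq` — the fibres of `intCompat M : (l·Δ_Θ)(𝕄_*) → (l·Δ_Θ)(𝕄_M) ⊗ ℤ/Mℤ`
  are the cosets of the `M`-th powers;
* **`EtaleLevels.bijective_rigidLimHom`** — the limit cyclotomic rigidity map `rigidLimHom` of part 5d IS
  BIJECTIVE, from part 6's residual `hZ : (l·Δ_Θ)/thetaKer ≅ Ẑ` ALONE (abstract isomorphism; injectivity =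
  `M`-adic separatedness, surjectivity = `M`-adic completeness, both inherited from `Ẑ`), i.e. the hypothesis `hlim`
  of `EtaleLevels.thetaEnvData` is DISCHARGED; whence `EtaleLevels.thetaEnvData'`-free corollaries
  `nonempty_thetaEnvData'`, `prop15_ii_iii_modelSystem'`, `prop15_ii_iii_modelSystem_of_cor218_i'`: [IUTchII]
  Prop. 1.5 (ii)+(iii) for the natural system modulo, BY NAME, only the level facts `RigidData.Cor218_i`,
  `ThetaEnvData.Cor218_iv_surjective` and the data inputs `Prop15iii`, `CuspLabels`, `hZ` (the last = GAP-LEDGER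
  G-w4d021-1, itself proved at the model by abc-iut-L2-d1's p415192 modulo `IsEtThOrigin` + G-w4d021-2).
HONEST FRAMING: conditional discharge; [IUTchII] claim key `Mochizuki2012` DISPUTED (D-0012); no side is taken on
[IUTchIII] Cor. 3.12; typed ≠ discharged.
v2 (doc-only, RQ7 audits abc-iut-w4-d042 / w5-d123 LOW nit): the six folklore `Ẑ` / commutative-group lemmas now carry
the [EtTh] §1 p. 12 anchor and the word "folklore" instead of an [IUTchI] Lem. 2.7 (v) locator; no Lean content changed.
-/

noncomputable section

namespace Literature.IUT.HodgeArakelov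

open Literature.AnabelianGeometry.EtaleTheta Literature.AnabelianGeometry.SemiGraphs
open scoped Literature.AnabelianGeometry.EtaleTheta

namespace EtaleLevels

/-! ## `Ẑ` is `M`-adically separated and complete -/

/-- In `Ẑ`, the components of a power are the powers of the components (bookkeeping). (folklore on `Ẑ = lim_M ℤ/Mℤ`; anchor: `Δ_Θ ≅ Ẑ(1)`) [cite: MochizukiEtTh2009, §1 p.12] -/
theorem zHat_val_pow (y : Literature.IUT.HodgeTheaters.ZHat) (n : ℕ)
    (U : FiniteIndexNormalSubgroup (Multiplicative ℤ)) : (y ^ n).val U = (y.val U) ^ n :=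
  rfl

/-- **`⋂_{M ≥ 1} Ẑ^M = 1`**: an element of `Ẑ` which is an `M`-th power for every `M ≥ 1` is trivial (its component
in the finite quotient `ℤ/U` of index `M` is an `M`-th power, hence trivial). (folklore on `Ẑ = lim_M ℤ/Mℤ`; anchor: `Δ_Θ ≅ Ẑ(1)`) [cite: MochizukiEtTh2009, §1 p.12] -/
theorem zHat_eq_one_of_forall_exists_pow_eq (z : Literature.IUT.HodgeTheaters.ZHat)
    (h : ∀ M : ℕ+, ∃ y : Literature.IUT.HodgeTheaters.ZHat, y ^ (M : ℕ) = z) : z = 1 := by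
  apply Subtype.ext
  funext U
  obtain ⟨y, hy⟩ := h ⟨U.toSubgroup.index, Nat.pos_of_ne_zero Subgroup.FiniteIndex.index_ne_zero⟩
  rw [← hy, zHat_val_pow]
  change (y.val U : Multiplicative ℤ ⧸ U.toSubgroup) ^ U.toSubgroup.index = 1
  obtain ⟨g, hg⟩ := QuotientGroup.mk_surjective (y.val U : Multiplicative ℤ ⧸ U.toSubgroup)
  rw [← hg]
  change (QuotientGroup.mk (g ^ U.toSubgroup.index) : Multiplicative ℤ ⧸ U.toSubgroup) = 1
  rw [QuotientGroup.eq_one_iff]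
  exact U.toSubgroup.pow_index_mem g

/-- **`Ẑ` is `M`-adically complete** (`Ẑ → lim_M Ẑ/Ẑ^M` is onto): a family `(a_M)_{M ≥ 1}` of elements of `Ẑ` with
`a_{M'} ∈ a_M · Ẑ^M` whenever `M ∣ M'` admits `z ∈ Ẑ` with `z ∈ a_M · Ẑ^M` for all `M` — the cosets `a_M Ẑ^M` form a
directed family of non-empty compact closed subsets of the compact group `Ẑ`. (folklore on `Ẑ = lim_M ℤ/Mℤ`; anchor: `Δ_Θ ≅ Ẑ(1)`) [cite: MochizukiEtTh2009, §1 p.12] -/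
theorem zHat_exists_of_powCompatible (a : ℕ+ → Literature.IUT.HodgeTheaters.ZHat)
    (ha : ∀ M M' : ℕ+, (M : ℕ) ∣ (M' : ℕ) →
      ∃ y : Literature.IUT.HodgeTheaters.ZHat, a M' = a M * y ^ (M : ℕ)) :
    ∃ z : Literature.IUT.HodgeTheaters.ZHat, ∀ M : ℕ+,
      ∃ y : Literature.IUT.HodgeTheaters.ZHat, z = a M * y ^ (M : ℕ) := by
  let Cs : ℕ+ → Set Literature.IUT.HodgeTheaters.ZHat := fun M =>
    Set.range fun y : Literature.IUT.HodgeTheaters.ZHat => a M * y ^ (M : ℕ)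
  have hsub : ∀ M M' : ℕ+, (M : ℕ) ∣ (M' : ℕ) → Cs M' ⊆ Cs M := by
    intro M M' hMM'
    obtain ⟨k, hk⟩ := hMM'
    obtain ⟨w, hw⟩ := ha M M' ⟨k, hk⟩
    rintro _ ⟨y, rfl⟩
    refine ⟨w * y ^ k, ?_⟩
    have hc : Commute w (y ^ k) := Literature.IUT.HodgeTheaters.ZHat.mul_comm w (y ^ k)
    change a M * (w * y ^ k) ^ (M : ℕ) = a M' * y ^ (M' : ℕ)
    rw [hw, hc.mul_pow, ← pow_mul', ← hk, mul_assoc]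
  have hdir : Directed (· ⊇ ·) Cs := fun M₁ M₂ =>
    ⟨M₁ * M₂, hsub M₁ (M₁ * M₂) (by rw [PNat.mul_coe]; exact dvd_mul_right _ _),
      hsub M₂ (M₁ * M₂) (by rw [PNat.mul_coe]; exact dvd_mul_left _ _)⟩
  have hne : ∀ M, (Cs M).Nonempty := fun M => ⟨a M * 1 ^ (M : ℕ), 1, rfl⟩
  have hcomp : ∀ M, IsCompact (Cs M) := fun M =>
    isCompact_range (continuous_const.mul (continuous_pow (M : ℕ)))
  have hclosed : ∀ M, IsClosed (Cs M) := fun M => (hcomp M).isClosed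
  obtain ⟨z, hz⟩ := IsCompact.nonempty_iInter_of_directed_nonempty_isCompact_isClosed Cs hdir hne hcomp hclosed
  refine ⟨z, fun M => ?_⟩
  obtain ⟨y, hy⟩ := Set.mem_iInter.mp hz M
  exact ⟨y, hy.symm⟩

/-- `⋂_M B^M = 1` for any group `B` abstractly isomorphic to `Ẑ`. (folklore on `Ẑ = lim_M ℤ/Mℤ`; anchor: `Δ_Θ ≅ Ẑ(1)`) [cite: MochizukiEtTh2009, §1 p.12] -/
theorem eq_one_of_forall_exists_pow_eq_of_mulEquiv_zHat {B : Type*} [Group B]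
    (e : B ≃* Literature.IUT.HodgeTheaters.ZHat) (b : B) (h : ∀ M : ℕ+, ∃ y : B, y ^ (M : ℕ) = b) : b = 1 := by
  apply e.injective
  rw [map_one]
  refine zHat_eq_one_of_forall_exists_pow_eq (e b) fun M => ?_
  obtain ⟨y, hy⟩ := h M
  exact ⟨e y, by rw [← map_pow, hy]⟩

/-- `M`-adic completeness for any group `B` abstractly isomorphic to `Ẑ`. (folklore on `Ẑ = lim_M ℤ/Mℤ`; anchor: `Δ_Θ ≅ Ẑ(1)`) [cite: MochizukiEtTh2009, §1 p.12] -/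
theorem exists_of_powCompatible_of_mulEquiv_zHat {B : Type*} [Group B]
    (e : B ≃* Literature.IUT.HodgeTheaters.ZHat) (a : ℕ+ → B)
    (ha : ∀ M M' : ℕ+, (M : ℕ) ∣ (M' : ℕ) → ∃ y : B, a M' = a M * y ^ (M : ℕ)) :
    ∃ z : B, ∀ M : ℕ+, ∃ y : B, z = a M * y ^ (M : ℕ) := by
  obtain ⟨z, hz⟩ := zHat_exists_of_powCompatible (fun M => e (a M)) fun M M' h => by
    obtain ⟨y, hy⟩ := ha M M' h
    exact ⟨e y, by rw [hy, map_mul, map_pow]⟩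
  refine ⟨e.symm z, fun M => ?_⟩
  obtain ⟨y, hy⟩ := hz M
  refine ⟨e.symm y, e.injective ?_⟩
  rw [MulEquiv.apply_symm_apply, map_mul, map_pow, MulEquiv.apply_symm_apply]
  exact hy

/-- In a group all of whose elements commute, the normal closure of the `n`-th powers consists of `n`-th powers.
(folklore on `Ẑ = lim_M ℤ/Mℤ`; anchor: `Δ_Θ ≅ Ẑ(1)`) [cite: MochizukiEtTh2009, §1 p.12] -/
theorem exists_pow_eq_of_mem_normalClosure {B : Type*} [Group B] (hcomm : ∀ x y : B, x * y = y * x) (n : ℕ)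
    {b : B} (hb : b ∈ Subgroup.normalClosure (Set.range fun y : B => y ^ n)) : ∃ y : B, y ^ n = b := by
  let f : B →* B := MonoidHom.mk' (fun y : B => y ^ n) fun x y => (show Commute x y from hcomm x y).mul_pow n
  haveI : f.range.Normal := ⟨fun a ha g => by rwa [hcomm g a, mul_inv_cancel_right]⟩
  have hle : Subgroup.normalClosure (Set.range fun y : B => y ^ n) ≤ f.range :=
    Subgroup.normalClosure_le_normal fun _ ⟨y, hy⟩ => ⟨y, hy⟩
  obtain ⟨y, hy⟩ := hle hb
  exact ⟨y, hy⟩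

variable {p : ℕ} [Fact p.Prime] {D : Literature.AnabelianGeometry.EtaleTheta.ThetaSetting p}
  {E : D.EtaleThetaData} {l : ℕ} (C : E.DoubleUnderline l) (hC : D.Compat) (hS : D.Sec2Hyps)
  (hl : l.Prime) (hp2 : p ≠ 2) (hpl : p ≠ l) (hζ : ∃ ζ : D.K, IsPrimitiveRoot ζ (4 * l))
  (mods : ∀ M : ℕ+, D.CyclotomeMod l M)
  (f : contCocycles D.toTheta D.DeltaTheta C.GtpYdduu) (hf : f ∈ C.rootCocycles hC)
  (hmods : ∀ (M M' : ℕ+) (h : (M : ℕ) ∣ (M' : ℕ)) (x : D.lDeltaTheta l),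
    MuN.red p M M' h ((mods M').red x) = (mods M).red x)
  (h15 : Literature.AnabelianGeometry.EtaleTheta.ThetaSetting.Prop15iii E hC) (L : C.CuspLabels)
  (hZ : ∀ M : ℕ+, Nonempty (ModelCyclotomes.lDeltaQuot (C.rigidData (mods M) hC hS h15 L) ≃*
    Literature.IUT.HodgeTheaters.ZHat))
  (hcharY : EtaleThetaDataOfSetting.PiYddCharacteristic C)

/-! ## The fibres of `intCompat M` -/

/-- `intCompat M` read through `intCycEquiv`: it IS the reduction `(l·Δ_Θ)(𝕄_*) → (l·Δ_Θ)(𝕄_*) ⊗ ℤ/Mℤ`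
(bookkeeping). [claim: Mochizuki2012, status: disputed] (IUTchII §1 Prop 1.5 (iii), kurims p.29) -/
theorem modPowCongr_intCompat (M : ℕ+) (a : (EtaleThetaDataOfSetting.lDeltaSubquotient C).carrier) :
    ModelCyclotomes.modPowCongr (ModelCyclotomes.intCycEquiv (C.rigidData (mods M) hC hS h15 L)) (M : ℕ)
        (intCompat C hC hS mods h15 L M a) =
      (QuotientGroup.mk a : ModPow (EtaleThetaDataOfSetting.lDeltaSubquotient C).carrier (M : ℕ)) := by
  change ModelCyclotomes.modPowCongr (ModelCyclotomes.intCycEquiv (C.rigidData (mods M) hC hS h15 L)) (M : ℕ)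
      (QuotientGroup.mk ((ModelCyclotomes.intCycEquiv (C.rigidData (mods M) hC hS h15 L)).symm a)) = _
  rw [ModelCyclotomes.modPowCongr_mk, MulEquiv.apply_symm_apply]
  rfl

include hZ in
/-- **The fibres of `intCompat M` are the cosets of the `M`-th powers**: `intCompat M a = intCompat M b` iff
`b ∈ a · ((l·Δ_Θ)(𝕄_*))^M` (the interior cyclotome is commutative, being abstractly `≅ Ẑ` by `hZ`).
[claim: Mochizuki2012, status: disputed] (IUTchII §1 Prop 1.5 (iii), kurims p.29) -/
theorem exists_pow_eq_of_intCompat_eq (M : ℕ+) (a b : (EtaleThetaDataOfSetting.lDeltaSubquotient C).carrier)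
    (h : intCompat C hC hS mods h15 L M a = intCompat C hC hS mods h15 L M b) :
    ∃ y : (EtaleThetaDataOfSetting.lDeltaSubquotient C).carrier, b = a * y ^ (M : ℕ) := by
  have e : (EtaleThetaDataOfSetting.lDeltaSubquotient C).carrier ≃* Literature.IUT.HodgeTheaters.ZHat :=
    (hZ M).some
  have hcomm : ∀ x y : (EtaleThetaDataOfSetting.lDeltaSubquotient C).carrier, x * y = y * x := fun x y =>
    e.injective (by rw [map_mul, map_mul, Literature.IUT.HodgeTheaters.ZHat.mul_comm])
  have h1 : intCompat C hC hS mods h15 L M (a⁻¹ * b) = 1 := by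
    rw [map_mul, map_inv, h, inv_mul_cancel]
  have h2 : (QuotientGroup.mk (a⁻¹ * b) :
      ModPow (EtaleThetaDataOfSetting.lDeltaSubquotient C).carrier (M : ℕ)) = 1 := by
    rw [← modPowCongr_intCompat C hC hS mods h15 L M, h1, map_one]
    rfl
  rw [QuotientGroup.eq_one_iff] at h2
  obtain ⟨y, hy⟩ := exists_pow_eq_of_mem_normalClosure hcomm (M : ℕ) h2
  exact ⟨y, by rw [hy, mul_inv_cancel_left]⟩

/-- `intCompat M` kills `M`-th powers. [claim: Mochizuki2012, status: disputed] (IUTchII §1 Prop 1.5 (iii), kurims p.29) -/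
theorem intCompat_pow (M : ℕ+) (y : (EtaleThetaDataOfSetting.lDeltaSubquotient C).carrier) :
    intCompat C hC hS mods h15 L M (y ^ (M : ℕ)) = 1 := by
  have h : (QuotientGroup.mk (y ^ (M : ℕ)) :
      ModPow (EtaleThetaDataOfSetting.lDeltaSubquotient C).carrier (M : ℕ)) = 1 :=
    (QuotientGroup.eq_one_iff _).mpr (Subgroup.subset_normalClosure ⟨y, rfl⟩)
  apply (ModelCyclotomes.modPowCongr (ModelCyclotomes.intCycEquiv (C.rigidData (mods M) hC hS h15 L))
    (M : ℕ)).injective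
  rw [map_one]
  exact (modPowCongr_intCompat C hC hS mods h15 L M (y ^ (M : ℕ))).trans h

/-- `intCompat M` is onto. [claim: Mochizuki2012, status: disputed] (IUTchII §1 Prop 1.5 (iii), kurims p.29) -/
theorem intCompat_surjective (M : ℕ+) : Function.Surjective (intCompat C hC hS mods h15 L M) :=
  (QuotientGroup.mk'_surjective _).comp
    (ModelCyclotomes.intCycEquiv (C.rigidData (mods M) hC hS h15 L)).symm.surjective

/-! ## The limit cyclotomic rigidity map is an isomorphism -/

include hmods in
/-- **The limit cyclotomic rigidity map `(l·Δ_Θ)(𝕄_*) → Π_μ(𝕄_*)` IS BIJECTIVE** — the hypothesis `hlim` of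
`EtaleLevels.thetaEnvData` DISCHARGED from `hZ : (l·Δ_Θ)/thetaKer ≅ Ẑ` alone: injective because an element in the
kernel is an `M`-th power for every `M` (`⋂_M Ẑ^M = 1`); surjective because a compatible element of
`Π_μ(𝕄_*) = lim_M μ_M` lifts level-wise (`intCompat M` onto, the mod-`M` rigidity isomorphisms bijective) to a family
`(a_M)` with `a_{M'} ∈ a_M ((l·Δ_Θ)(𝕄_*))^M`, interpolated by `M`-adic completeness of `Ẑ`.
[claim: Mochizuki2012, status: disputed] (IUTchII §1 Prop 1.5 (iii), kurims p.29) -/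
theorem bijective_rigidLimHom :
    Function.Bijective (rigidLimHom C hC hS hl hp2 hpl hζ mods f hf hmods h15 L hZ) := by
  have e : (EtaleThetaDataOfSetting.lDeltaSubquotient C).carrier ≃* Literature.IUT.HodgeTheaters.ZHat :=
    (hZ 1).some
  constructor
  · rw [← MonoidHom.ker_eq_bot_iff, Subgroup.eq_bot_iff_forall]
    intro a ha
    rw [MonoidHom.mem_ker] at ha
    refine eq_one_of_forall_exists_pow_eq_of_mulEquiv_zHat e a fun M => ?_
    have hM : ((rigidLimHom C hC hS hl hp2 hpl hζ mods f hf hmods h15 L hZ a : ∀ M',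
        ((modelSystem C hC hS hl hp2 hpl hζ mods f hf hmods h15 L hZ).env M').Pi) M) = 1 := by
      rw [ha]
      rfl
    have h1 : (rigid C hC hS hl hp2 hpl hζ mods f hf h15 L hZ M).iso (intCompat C hC hS mods h15 L M a) = 1 :=
      Subtype.ext hM
    have h2 : intCompat C hC hS mods h15 L M a = 1 := (MulEquiv.map_eq_one_iff _).mp h1
    obtain ⟨y, hy⟩ := exists_pow_eq_of_intCompat_eq C hC hS mods h15 L hZ M 1 a (by rw [map_one, h2])
    exact ⟨y, by rw [hy, one_mul]⟩
  · intro x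
    have hx := x.2
    -- level-wise lifts
    have hlift : ∀ M : ℕ+, ∃ aM : (EtaleThetaDataOfSetting.lDeltaSubquotient C).carrier,
        ((rigid C hC hS hl hp2 hpl hζ mods f hf h15 L hZ M).iso (intCompat C hC hS mods h15 L M aM)).val =
          (x : ∀ M', ((modelSystem C hC hS hl hp2 hpl hζ mods f hf hmods h15 L hZ).env M').Pi) M := by
      intro M
      obtain ⟨c, hc⟩ := (rigid C hC hS hl hp2 hpl hζ mods f hf h15 L hZ M).iso.surjective ⟨_, hx.1 M⟩
      obtain ⟨aM, haM⟩ := intCompat_surjective C hC hS mods h15 L M c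
      exact ⟨aM, by rw [haM, hc]⟩
    choose a ha using hlift
    have hcompat : ∀ M M' : ℕ+, (M : ℕ) ∣ (M' : ℕ) →
        ∃ y : (EtaleThetaDataOfSetting.lDeltaSubquotient C).carrier, a M' = a M * y ^ (M : ℕ) := by
      intro M M' h
      apply exists_pow_eq_of_intCompat_eq C hC hS mods h15 L hZ M
      apply (rigid C hC hS hl hp2 hpl hζ mods f hf h15 L hZ M).iso.injective
      apply Subtype.ext
      exact (ha M).trans (((hx.2 M M' h).symm.trans (congrArg (red C hC hS mods h) (ha M').symm)).trans
        (red_rigid_iso_intCompat C hC hS hl hp2 hpl hζ mods f hf hmods h15 L hZ h (a M')))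
    obtain ⟨z, hz⟩ := exists_of_powCompatible_of_mulEquiv_zHat e a hcompat
    refine ⟨z, Subtype.ext (funext fun M => ?_)⟩
    obtain ⟨y, hy⟩ := hz M
    have hzM : intCompat C hC hS mods h15 L M z = intCompat C hC hS mods h15 L M (a M) := by
      rw [hy, map_mul, intCompat_pow, mul_one]
    exact (congrArg (fun c => ((rigid C hC hS hl hp2 hpl hζ mods f hf h15 L hZ M).iso c).val) hzM).trans (ha M)

/-! ## [IUTchII] Prop. 1.5 (iii) (and (ii)+(iii)) for the natural system, `hlim`-free -/

include hcharY in
/-- **The `θ_env` data of [IUTchII] Prop. 1.5 (iii) for the natural system EXIST**, modulo `PiYddCharacteristic C`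
only (the limit rigidity being an isomorphism by `bijective_rigidLimHom`).
[claim: Mochizuki2012, status: disputed] (IUTchII §1 Prop 1.5 (iii), kurims pp.29-30) -/
theorem nonempty_thetaEnvData' :
    Nonempty (ThetaEnvData (modelSystem C hC hS hl hp2 hpl hζ mods f hf hmods h15 L hZ)) :=
  nonempty_thetaEnvData C hC hS hl hp2 hpl hζ mods f hf hmods h15 L hZ hcharY
    (bijective_rigidLimHom C hC hS hl hp2 hpl hζ mods f hf hmods h15 L hZ)

include hcharY in
/-- **[IUTchII] Prop. 1.5 (ii)+(iii) for the natural system** (abc-iut-L6-t1's `Prop15_ii_iii (modelSystem …)`),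
modulo BY NAME: `hchar` (topological characteristicity of `Π^tp_{Y̲̲}`), `ThetaEnvData.Cor218_iv_surjective` (F-0639),
`PiYddCharacteristic C`; data inputs `Prop15iii`, `CuspLabels`, `hZ`. [claim: Mochizuki2012, status: disputed] (IUTchII §1 Prop 1.5 (ii)(iii), kurims pp.29-30) -/
theorem prop15_ii_iii_modelSystem'
    (hchar : Literature.AnabelianGeometry.EtaleTheta.IsTopCharacteristic ↥C.Huu (D.GtpY.subgroupOf C.Huu))
    (hsurj : ∀ M : ℕ+, (levelData C hC hS mods M).Cor218_iv_surjective) :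
    Literature.IUT.HodgeArakelov.Prop15_ii_iii (modelSystem C hC hS hl hp2 hpl hζ mods f hf hmods h15 L hZ) :=
  prop15_ii_iii_modelSystem C hC hS hl hp2 hpl hζ mods f hf hmods h15 L hZ hcharY hchar hsurj
    (bijective_rigidLimHom C hC hS hl hp2 hpl hζ mods f hf hmods h15 L hZ)

/-- **[IUTchII] Prop. 1.5 (ii)+(iii) for the natural system, NAMED-FACT form**: modulo, BY NAME, only the level
facts `RigidData.Cor218_i` ([EtTh] Cor. 2.18 (i), F-0620 class) and `ThetaEnvData.Cor218_iv_surjective` ([EtTh]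
Cor. 2.18 (iv), F-0639), with the data inputs `Prop15iii`, `CuspLabels`, `hZ`.
[claim: Mochizuki2012, status: disputed] (IUTchII §1 Prop 1.5 (ii)(iii), kurims pp.29-30) -/
theorem prop15_ii_iii_modelSystem_of_cor218_i'
    (h218i : ∀ M : ℕ+, (C.rigidData (mods M) hC hS h15 L).Cor218_i)
    (hsurj : ∀ M : ℕ+, (levelData C hC hS mods M).Cor218_iv_surjective) :
    Literature.IUT.HodgeArakelov.Prop15_ii_iii (modelSystem C hC hS hl hp2 hpl hζ mods f hf hmods h15 L hZ) :=
  prop15_ii_iii_modelSystem_of_cor218_i C hC hS hl hp2 hpl hζ mods f hf hmods h15 L hZ h218i hsurj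
    (bijective_rigidLimHom C hC hS hl hp2 hpl hζ mods f hf hmods h15 L hZ)

end EtaleLevels

end Literature.IUT.HodgeArakelov
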